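import Summits.RiemannHypothesis.RiemannHypothesis.Theorems.AsymptoticCriticalLine.Negative.Lindelof
import Literature.Barriers.RiemannHypothesis.LindelofBacklundProofs
import Literature.Barriers.RiemannHypothesis.LindelofBacklundMomentsProofs

/-!
# `AsymptoticCriticalLine ⟹ Lindelöf`, unconditionally (negative lemmas, cycle 3)

`Lindelof.lean` derived the Lindelöf hypothesis from the crux modulo the named fact
`Titchmarsh1986_thm13_5`; that fact (and Theorem 13.2) is PROVED in the tree
(`Literature.Barriers.RiemannHypothesis.Titchmarsh1986_thm13_5_holds`,
`Titchmarsh1986_thm13_2_holds`, files `LindelofBacklundProofs`, `LindelofBacklundMomentsProofs`),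
so the propagation is unconditional: `RH ⟹ crux ⟹ LH ⟹ …` and `crux ⟹ DH`; a kill of the crux is
implied by `¬LH` outright (`not_acl_of_not_lindelof'`). Any proof of the crux — in particular any
BandRealisation of route RuelleBand reaching rung #4 — contains a proof of the Lindelöf hypothesis.
-/

noncomputable section

namespace Summit.RiemannHypothesis.RiemannHypothesis.Theorems.AsymptoticCriticalLine.Negative

open Filter Asymptotics
open Summit.RiemannHypothesis.RiemannHypothesis.Theses.RuelleBand (AsymptoticCriticalLine)
open Literature.NumberTheory.LFunctions (LindelofHypothesis DensityHypothesis)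
open Literature.Barriers.RiemannHypothesis (Titchmarsh1986_thm13_5_holds Titchmarsh1986_thm13_2_holds
  criticalMoment)

/-- THE CRUX IMPLIES THE LINDELÖF HYPOTHESIS (unconditional: Backlund's condition from the crux,
`backlundZeroCondition_of_acl`, and Titchmarsh's Theorem 13.5, proved in tree). [folklore] -/
theorem lindelof_of_acl' (hacl : AsymptoticCriticalLine) : LindelofHypothesis :=
  lindelof_of_acl Titchmarsh1986_thm13_5_holds hacl

/-- KILL PROPAGATION: `¬LH ⟹ ¬crux`, unconditionally. [folklore] -/
theorem not_acl_of_not_lindelof' (hLH : ¬ LindelofHypothesis) : ¬ AsymptoticCriticalLine :=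
  fun hacl => hLH (lindelof_of_acl' hacl)

/-- Under the crux every critical moment `(1/T)∫₁^T |ζ(1/2+it)|^{2k} dt` is `O(T^ε)`
(unconditional in the facts: Theorems 13.5 and 13.2 are proved in tree). [folklore] -/
theorem criticalMoment_isBigO_of_acl' (hacl : AsymptoticCriticalLine) {k : ℕ} (hk : 1 ≤ k) {ε : ℝ}
    (hε : 0 < ε) : criticalMoment k =O[atTop] fun T : ℝ => T ^ ε :=
  criticalMoment_isBigO_of_acl Titchmarsh1986_thm13_5_holds Titchmarsh1986_thm13_2_holds hacl hk hε

/-- The unconditional sandwich `RH ⟹ crux ⟹ LH ∧ DH`. [folklore] -/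
theorem acl_sandwich' :
    (RiemannHypothesis → AsymptoticCriticalLine) ∧
      (AsymptoticCriticalLine → LindelofHypothesis ∧ DensityHypothesis) :=
  ⟨acl_sandwich.1, fun h => ⟨lindelof_of_acl' h, densityHypothesis_of_acl h⟩⟩

end Summit.RiemannHypothesis.RiemannHypothesis.Theorems.AsymptoticCriticalLine.Negative
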